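import Literature.Topology.FourManifolds.CompatibleOrientationTransport
import Literature.Topology.FourManifolds.ConnectedSum
import Literature.Topology.FourManifolds.BordismFourOrientation
import Literature.AlgebraicTopology.SingularHomology.LocalClassFamilies
import HarnessLib

/-!
# Compatible homological orientations restrict to open submanifolds

G. E. Bredon, *Topology and Geometry* (1993), VI.7 (Prop. 7.14 / Thm. 7.15) with A. Hatcher,
*Algebraic Topology* (2002), §3.3 p. 231 (excision `Hₙ(U | x) ≅ Hₙ(M | x)` for `U ⊆ M` open): a
homological orientation `μ` of `M` restricts to an orientation `μ|_U` of every open subset `U`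
(local classes pulled back along the excision isomorphism), and if `μ` is compatible with a
smooth orientation `o` (`SmoothOrientation.IsCompatible g o μ`) then `μ|_U` is compatible with
the restricted smooth orientation `o.restrict U` (`SmoothOrientation.restrict`,
`ConnectedSum.lean`): the charts of `U` are the restricted charts of `M`.

* `HomologicalOrientation.restrictOpens μ U` and `map_val_restrictOpens_localClass`;
* `SmoothOrientation.IsCompatible.restrictOpens`.

Everything is proved; no named facts.

## References

* G. E. Bredon, *Topology and Geometry*, GTM 139, Springer 1993, VI.7 Thm. 7.15. [Bredon1993]
* A. Hatcher, *Algebraic Topology*, CUP 2002, §3.3 p. 231. [HatcherAT2002]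
-/

open scoped Manifold ContDiff Topology
open Set Function CategoryTheory Module Metric TopologicalSpace Topology
open Literature.AlgebraicTopology.SingularHomology

noncomputable section

namespace Literature.AlgebraicTopology.SingularHomology

namespace HomologicalOrientation

variable {n : ℕ} {M : Type} [TopologicalSpace M] [T2Space M]
  [ChartedSpace (EuclideanSpace ℝ (Fin n)) M]

/-- The inclusion of an open subset, as a continuous map. [folklore] -/
abbrev valC (U : Opens M) : C(U, M) := ⟨Subtype.val, continuous_subtype_val⟩

omit [T2Space M] [ChartedSpace (EuclideanSpace ℝ (Fin n)) M] in
/-- The inclusion of an open subset is an open embedding. [folklore] -/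
theorem isOpenEmbedding_valC (U : Opens M) : IsOpenEmbedding (valC U) :=
  U.isOpen.isOpenEmbedding_subtypeVal

/-- **Restriction of a homological orientation to an open subset** (Hatcher 2002, §3.3 p. 231:
local orientations are local): the local class at `x ∈ U` is `μₓ` pulled back along the excision
isomorphism `Hₙ(U | x) ≅ Hₙ(M | x)`. [cite: HatcherAT2002, §3.3 p. 231] -/
def restrictOpens (μ : HomologicalOrientation ℤ M n) (U : Opens M) : HomologicalOrientation ℤ U n :=
  haveI hiso := fun x : U => localHomology.isIso_map_of_isOpenEmbedding_of_eq ℤ ℤ (valC U)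
    (isOpenEmbedding_valC U) x rfl n
  HomologicalOrientation.ofLocalFamily
    (fun x => inv (relativeSingularHomology.map ℤ ℤ (valC U)
      (LocalFamily.mapsTo_compl_pt Subtype.val_injective x) n) (μ.localClass x.1))
    (fun x => (Literature.Topology.FourManifolds.exists_linearEquiv_apply_eq_one_iff_of_isIso
      (relativeSingularHomology.map ℤ ℤ (valC U)
        (LocalFamily.mapsTo_compl_pt Subtype.val_injective x) n) _).1 (by
        rw [← ModuleCat.comp_apply, IsIso.inv_hom_id, ModuleCat.id_apply]
        exact μ.isGenerator x.1))
    (by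
      intro x
      haveI := ChartedSpace.locallyCompactSpace (EuclideanSpace ℝ (Fin n)) M
      -- a compact neighbourhood of `x.1` inside `U` on which `μ` is consistent
      obtain ⟨N, hN, hNμ⟩ := μ.consistentOn_nhds x.1
      have hUN : (U : Set M) ∩ N ∈ 𝓝 x.1 := Filter.inter_mem (U.isOpen.mem_nhds x.2) hN
      obtain ⟨K, hKn, hKU, hKc⟩ := local_compact_nhds hUN
      set K' : Set U := Subtype.val ⁻¹' K with hK'
      have hvalK' : (valC U) '' K' = K := by
        ext z; constructor
        · rintro ⟨y, hy, rfl⟩; exact hy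
        · intro hz; exact ⟨⟨z, (hKU hz).1⟩, hz, rfl⟩
      refine ⟨K', continuous_subtype_val.continuousAt.preimage_mem_nhds hKn, ?_⟩
      refine LocalFamily.ConsistentOn.preimage_of_isOpenEmbedding
        (β := (μ.localClass : LocalFamily ℤ ℤ M n)) (valC U) (isOpenEmbedding_valC U) ?_ ?_ ?_
      · rw [hvalK', hKc.isClosed.closure_eq]
        intro z hz
        exact ⟨⟨z, (hKU hz).1⟩, rfl⟩
      · rw [hvalK']
        exact hNμ.mono fun z hz => (hKU hz).2
      · intro y _
        rw [← ModuleCat.comp_apply, IsIso.inv_hom_id, ModuleCat.id_apply]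
        rfl)

/-- Defining property of the restriction: `val_* ((μ|_U)ₓ) = μₓ`. [folklore] -/
theorem map_val_restrictOpens_localClass (μ : HomologicalOrientation ℤ M n) (U : Opens M) (x : U) :
    relativeSingularHomology.map ℤ ℤ (valC U) (LocalFamily.mapsTo_compl_pt Subtype.val_injective x) n
      ((μ.restrictOpens U).localClass x) = μ.localClass x.1 := by
  haveI := localHomology.isIso_map_of_isOpenEmbedding_of_eq ℤ ℤ (valC U) (isOpenEmbedding_valC U)
    x rfl n
  change relativeSingularHomology.map ℤ ℤ (valC U) _ n
    (inv (relativeSingularHomology.map ℤ ℤ (valC U)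
      (LocalFamily.mapsTo_compl_pt Subtype.val_injective x) n) (μ.localClass x.1)) = _
  rw [← ModuleCat.comp_apply, IsIso.inv_hom_id, ModuleCat.id_apply]

end HomologicalOrientation

end Literature.AlgebraicTopology.SingularHomology

namespace Literature.Topology.FourManifolds

namespace SmoothOrientation

variable {n : ℕ} {M : Type} [TopologicalSpace M] [T2Space M]
  [ChartedSpace (EuclideanSpace ℝ (Fin n)) M] [IsManifold (𝓡 n) 1 M]

omit [T2Space M] [IsManifold (𝓡 n) 1 M] in
/-- The chart source of `U` at `x` lies over the chart source of `M` at `x.1` (the chart of `U`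
at `x` is the restriction of the chart of `M` at `x.1`, Mathlib's
`TopologicalSpace.Opens.chartAt_eq`). [folklore] -/
theorem mem_chartAt_source_coe (U : Opens M) (x : U) {y : U}
    (hy : y ∈ (chartAt (EuclideanSpace ℝ (Fin n)) x).source) :
    (y : M) ∈ (chartAt (EuclideanSpace ℝ (Fin n)) x.1).source := by
  have h : y ∈ ((chartAt (EuclideanSpace ℝ (Fin n)) x.1).subtypeRestr ⟨x⟩).source := hy
  rwa [OpenPartialHomeomorph.subtypeRestr_source] at h

/-- The inclusion of the chart source of `U` at `x` into the chart source of `M` at `x.1`.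
[folklore] -/
def chartSourceIncl (U : Opens M) (x : U) :
    C(↥(chartAt (EuclideanSpace ℝ (Fin n)) x).source, ↥(chartAt (EuclideanSpace ℝ (Fin n)) x.1).source) :=
  ⟨fun y => ⟨y.1.1, mem_chartAt_source_coe U x y.2⟩,
    (continuous_subtype_val.comp continuous_subtype_val).subtype_mk _⟩

omit [T2Space M] [IsManifold (𝓡 n) 1 M] in
/-- Values of `chartSourceIncl`. [folklore] -/
@[simp] theorem chartSourceIncl_apply_coe (U : Opens M) (x : U)
    (y : ↥(chartAt (EuclideanSpace ℝ (Fin n)) x).source) :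
    ((chartSourceIncl U x y : ↥(chartAt (EuclideanSpace ℝ (Fin n)) x.1).source) : M) = y.1.1 := rfl

omit [T2Space M] [IsManifold (𝓡 n) 1 M] in
/-- `chartSourceIncl` is injective. [folklore] -/
theorem chartSourceIncl_injective (U : Opens M) (x : U) :
    Injective (chartSourceIncl (n := n) U x) :=
  fun _ _ h => Subtype.ext (Subtype.ext (congrArg (fun z : ↥(chartAt _ x.1).source => (z : M)) h))

omit [T2Space M] [IsManifold (𝓡 n) 1 M] in
/-- `chartSourceIncl` is an open embedding (an open subset of an open subset). [folklore] -/
theorem isOpenEmbedding_chartSourceIncl (U : Opens M) (x : U) :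
    IsOpenEmbedding (chartSourceIncl (n := n) U x) := by
  have h1 : IsOpenEmbedding (fun y : ↥(chartAt (EuclideanSpace ℝ (Fin n)) x).source => (y.1.1 : M)) :=
    U.isOpen.isOpenEmbedding_subtypeVal.comp
      (chartAt (EuclideanSpace ℝ (Fin n)) x).open_source.isOpenEmbedding_subtypeVal
  have h2 : (fun y : ↥(chartAt (EuclideanSpace ℝ (Fin n)) x.1).source => (y : M)) ∘
      chartSourceIncl (n := n) U x = fun y => (y.1.1 : M) := rfl
  rw [← h2] at h1
  exact IsOpenEmbedding.of_comp _
    (chartAt (EuclideanSpace ℝ (Fin n)) x.1).open_source.isOpenEmbedding_subtypeVal h1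

/-- **Compatibility restricts to open submanifolds** (Bredon 1993, VI.7; the charts of `U` are
the restricted charts of `M`): if `μ` is compatible with `o` then `μ|_U` is compatible with
`o.restrict U`. [cite: Bredon1993, VI.7 Thm. 7.15] -/
theorem IsCompatible.restrictOpens {g : HomologicalOrientation ℤ (EuclideanSpace ℝ (Fin n)) n}
    {o : SmoothOrientation (𝓡 n) M} {μ : HomologicalOrientation ℤ M n} (h : IsCompatible g o μ)
    (U : Opens M) : IsCompatible g (o.restrict U) (μ.restrictOpens U) := by
  intro x
  obtain ⟨c, ε, h₁, h₂, h₃⟩ := h x.1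
  set ι := chartSourceIncl (n := n) U x with hι
  have mι : MapsTo ι ({chartSourcePt x}ᶜ : Set _) ({chartSourcePt x.1}ᶜ : Set _) :=
    LocalFamily.mapsTo_compl_pt (chartSourceIncl_injective U x) (chartSourcePt x)
  haveI iι : IsIso (relativeSingularHomology.map ℤ ℤ ι mι n) :=
    Literature.AlgebraicTopology.SingularHomology.localHomology.isIso_map_of_isOpenEmbedding_of_eq
      ℤ ℤ ι (isOpenEmbedding_chartSourceIncl U x) (chartSourcePt x) rfl n
  -- the two squares: `pushChart^U = pushChart^M ∘ ι_*`, `val_* ∘ pushIncl^U = pushIncl^M ∘ ι_*`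
  have sq1 : relativeSingularHomology.map ℤ ℤ ι mι n ≫ pushChart x.1 n = pushChart x n := by
    change relativeSingularHomology.map ℤ ℤ ι mι n ≫
      Literature.AlgebraicTopology.SingularHomology.localHomology.push _ _ _ _ n =
      Literature.AlgebraicTopology.SingularHomology.localHomology.push _ _ _ _ n
    rw [Literature.AlgebraicTopology.SingularHomology.localHomology.push_def,
      Literature.AlgebraicTopology.SingularHomology.localHomology.push_def,
      ← relativeSingularHomology.map_comp]
    rfl
  have mval : MapsTo (HomologicalOrientation.valC U) ({x}ᶜ : Set U) ({x.1}ᶜ : Set M) :=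
    LocalFamily.mapsTo_compl_pt Subtype.val_injective x
  have sq2 : pushIncl x n ≫ relativeSingularHomology.map ℤ ℤ (HomologicalOrientation.valC U) mval n =
      relativeSingularHomology.map ℤ ℤ ι mι n ≫ pushIncl x.1 n := by
    change Literature.AlgebraicTopology.SingularHomology.localHomology.push _ _ _ _ n ≫ _ =
      _ ≫ Literature.AlgebraicTopology.SingularHomology.localHomology.push _ _ _ _ n
    rw [Literature.AlgebraicTopology.SingularHomology.localHomology.push_def,
      Literature.AlgebraicTopology.SingularHomology.localHomology.push_def,
      ← relativeSingularHomology.map_comp, ← relativeSingularHomology.map_comp]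
    rfl
  refine ⟨inv (relativeSingularHomology.map ℤ ℤ ι mι n) c, ε, ?_, ?_, h₃⟩
  · -- compare after `val_*`, injective
    haveI := Literature.AlgebraicTopology.SingularHomology.localHomology.isIso_map_of_isOpenEmbedding_of_eq
      ℤ ℤ (HomologicalOrientation.valC U) (HomologicalOrientation.isOpenEmbedding_valC U) x rfl n
    apply (ModuleCat.mono_iff_injective
      (relativeSingularHomology.map ℤ ℤ (HomologicalOrientation.valC U) mval n)).1 inferInstance
    rw [HomologicalOrientation.map_val_restrictOpens_localClass, ← h₁, ← ModuleCat.comp_apply, sq2,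
      ModuleCat.comp_apply, ← ModuleCat.comp_apply (inv _), IsIso.inv_hom_id, ModuleCat.id_apply]
  · have e : pushChart x n (inv (relativeSingularHomology.map ℤ ℤ ι mι n) c) =
        pushChart x.1 n (relativeSingularHomology.map ℤ ℤ ι mι n
          (inv (relativeSingularHomology.map ℤ ℤ ι mι n) c)) := by
      rw [← sq1]; rfl
    rw [e, ← ModuleCat.comp_apply (inv _), IsIso.inv_hom_id, ModuleCat.id_apply]
    exact h₂

end SmoothOrientation

end Literature.Topology.FourManifolds
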